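import Literature.AlgebraicGeometry.ComplexMultiplication.EndFieldCMOfPositiveInvolution
import Literature.AlgebraicGeometry.ComplexMultiplication.FieldOfDegreeTwoDimSimpleOverSubfield
import Mathlib.RingTheory.Trace.Basic
import HarnessLib

/-!
# A full-degree endomorphism field with a positive involution is CM — over a subfield `k ⊆ ℂ`

G. Shimura, *Abelian Varieties with Complex Multiplication and Modular Functions* (1998), §5.1
Proposition 5 (p. 38) with Lemma 2 (p. 37) and §5.2 (pp. 39–40: «`F` must be totally imaginary»): the endomorphism
algebra of a simple abelian variety carries the positive (Rosati) involution of §1.3, whence its centre is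
totally real or CM; for a variety of CM type the field is totally imaginary, hence CM.  The tree has this for
COMPLEX abelian varieties `A : AbelianVariety ℂ` (`EndFieldCMOfPositiveInvolution`:
`ne_id_and_isCMField_of_trace_mul_nonneg`; `CMFieldActionHOne.isTotallyComplex`).  Arithmetic consumers —
[Liu2021] App. D §D.4 (FJcycle.tex l. 5626–5627: «Let `B_0` be some simple factor of `B` over `E`. Then `B_0`
has complex multiplications by some subfield `M_0 ⊆ ℂ`») — meet an abelian variety `B₀` over a SUBFIELD
`k ⊆ ℂ` (a number field), simple over `k`, with `M = End⁰_k(B₀)` a field of degree `2 dim B₀`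
(★ `FieldOfDegreeTwoDimSimpleOverSubfield`: `bijective_of_isSimple_over_of_finrank_eq`); `B₀ ⊗_k ℂ` need not
be simple, and full degree alone does not make `M` CM (`ℚ(√(1+i)) ⊂ M₂(ℚ(i)) = End⁰(E × E)` for a CM
elliptic curve `E` with `End⁰(E) = ℚ(i)` is a field of degree `4 = 2 dim` with no real quadratic subfield).

THIS FILE transports the complex statements along the base change `End⁰_k(B₀) → End⁰_ℂ(B₀ ⊗_k ℂ)`
(★ `AbelianVariety.endAlgebraBaseChange`, `AbelianVariety.dim_baseChange`):

* §1 `isTotallyComplex_of_ringHom_endAlgebra_over` — a number field `M` of degree `2 dim B₀` mapping to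
  `End⁰_k(B₀)` is totally complex (and `not_isTotallyReal_of_ringHom_endAlgebra_over`);
* §2 `ne_id_and_isCMField_of_trace_mul_nonneg_over` — if moreover `M` carries a ring endomorphism `ρ` with
  non-negative trace form `0 ≤ Tr_{M/ℚ}(x·ρx)`, then `ρ ≠ id` and `M` is a CM field, `ρ` acting as complex
  conjugation under every embedding (`apply_eq_conj_of_trace_mul_nonneg_over`);
* §3 the same read on `End⁰_k(B₀)` for `B₀` SIMPLE over `k`: a trace-non-negative ring (= anti-ring, `End⁰_k`
  being commutative) endomorphism `τ` of `End⁰_k(B₀)` makes `M` a CM field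
  (`isCMField_of_isSimple_over_of_trace_mul_nonneg`; the trace form is transported along the bijection
  `M ≃ End⁰_k(B₀)`; `Tr` on `End⁰_k(B₀)` is the trace of left multiplication, `LinearMap.trace ∘ Algebra.lmul`).

What is NOT here (the one printed sentence left to a consumer): the positivity `0 < Tr(x·x†)` of the Rosati
involution of a `k`-rational polarisation (Mumford §21 Thm. 1) — taken as the hypothesis `hρ` / `hτ`.
Theorems only; no definition, no named fact, no instance, no `sorry`.

## References
* [Shimura1998] G. Shimura, *Abelian Varieties with Complex Multiplication and Modular Functions*, Princeton
  (1998), §5.1 Lemma 2 (p. 37) and Proposition 5 (p. 38), §5.2 (pp. 39–40).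
* [MumfordAV1970] D. Mumford, *Abelian Varieties* (1970), §19 (base change of endomorphisms), §21 Thm. 1
  (positivity of the Rosati involution).
* [Liu2021] Y. Liu, *Fourier–Jacobi cycles and arithmetic relative trace formula*, Camb. J. Math. 9 (2021),
  App. D §D.4.
-/

noncomputable section

open NumberField
open scoped ComplexConjugate

namespace Literature.AlgebraicGeometry.ComplexMultiplication

open Literature.AlgebraicGeometry.Motives Literature.NumberTheory.NumberFields

/-! ## §0 Transport of the trace form along a bijective ring homomorphism -/

/-- The trace form is invariant under a bijective ring homomorphism of `ℚ`-algebras (possibly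
non-commutative target, where `Tr` means the trace of LEFT multiplication `Algebra.lmul`): `Tr(L_{i x}) = Tr_{M/ℚ}(x)` —
left multiplication by `i x` is conjugate to left multiplication by `x` under the `ℚ`-linear equivalence `i`.
[folklore] -/
private theorem trace_lmul_eq_trace_of_bijective {M S : Type*} [CommRing M] [Algebra ℚ M] [Ring S]
    [Algebra ℚ S] (i : M →+* S) (hi : Function.Bijective i) (x : M) :
    LinearMap.trace ℚ S (Algebra.lmul ℚ S (i x)) = Algebra.trace ℚ M x := by
  let e : M ≃ₗ[ℚ] S := LinearEquiv.ofBijective (i.toRatAlgHom).toLinearMap hi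
  have he : ∀ y, e y = i y := fun _ => rfl
  have hconj : (Algebra.lmul ℚ S (i x) : S →ₗ[ℚ] S) = e.conj (Algebra.lmul ℚ M x) := by
    refine LinearMap.ext fun s => ?_
    obtain ⟨m, rfl⟩ := hi.2 s
    rw [LinearEquiv.conj_apply, LinearMap.comp_apply, LinearMap.comp_apply, LinearEquiv.coe_coe,
      LinearEquiv.coe_coe, ← he m, LinearEquiv.symm_apply_apply]
    change i x * e m = e (x * m)
    rw [he, he, map_mul]
  rw [Algebra.trace_apply, hconj, LinearMap.trace_conj']

/-! ## §1 A number field of degree `2 dim B₀` in `End⁰_k(B₀)` is totally complex -/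

section OverSubfield

variable {k : Type} [Field k] [Algebra k ℂ] {B₀ : AbelianVariety k} {M : Type} [Field M] [NumberField M]
  (φ : M →+* B₀.endAlgebra) (hM : Module.finrank ℚ M = 2 * B₀.dim)

include φ hM

/-- **A number field `M` of degree `2 dim B₀` mapping to `End⁰_k(B₀)`, `k ⊆ ℂ` a subfield, is TOTALLY
COMPLEX**: compose with the base change `End⁰_k(B₀) → End⁰_ℂ(B₀ ⊗_k ℂ)` (`dim (B₀ ⊗_k ℂ) = dim B₀`) and
apply the complex statement `CMFieldActionHOne.isTotallyComplex` (Shimura §5.2 «`F` must be totally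
imaginary»). [cite: Shimura1998, §5.2 (pp. 39–40)] [cite: MumfordAV1970, §19] -/
theorem isTotallyComplex_of_ringHom_endAlgebra_over : IsTotallyComplex M :=
  isTotallyComplex ((AbelianVariety.endAlgebraBaseChange ℂ B₀).toRingHom.comp φ)
    (by rw [AbelianVariety.dim_baseChange]; exact hM)

/-- … hence `M` is NOT totally real. [cite: Shimura1998, §5.2 (pp. 39–40)] -/
theorem not_isTotallyReal_of_ringHom_endAlgebra_over : ¬ IsTotallyReal M := by
  intro hR
  haveI := isTotallyComplex_of_ringHom_endAlgebra_over φ hM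
  let w : InfinitePlace M := Classical.choice inferInstance
  exact InfinitePlace.not_isReal_iff_isComplex.2 (IsTotallyComplex.isComplex w) (hR.isReal w)

/-! ## §2 … and with a trace-non-negative ring endomorphism it is a CM field -/

/-- **Shimura §5.1 Prop. 5 (printed route) over a subfield `k ⊆ ℂ`**: a number field `M` of degree
`2 dim B₀` mapping to `End⁰_k(B₀)` and carrying a ring endomorphism `ρ` with non-negative trace form
`0 ≤ Tr_{M/ℚ}(x·ρx)` (the Rosati involution of a `k`-polarisation restricted to `M`, Mumford §21 Thm. 1 —
a hypothesis here) has `ρ ≠ id` and is a CM field. [cite: Shimura1998, §5.1 Proposition 5 and Lemma 2 (pp. 37–38)]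
[cite: MumfordAV1970, §21 Thm. 1] -/
theorem ne_id_and_isCMField_of_trace_mul_nonneg_over (ρ : M →+* M)
    (hρ : ∀ x : M, 0 ≤ Algebra.trace ℚ M (x * ρ x)) : ρ ≠ RingHom.id M ∧ IsCMField M := by
  haveI := isTotallyComplex_of_ringHom_endAlgebra_over φ hM
  exact ⟨ne_id_of_trace_mul_nonneg_of_isTotallyComplex ρ hρ,
    isCMField_of_trace_mul_nonneg_of_isTotallyComplex ρ hρ⟩

/-- … `M` is a CM field. [cite: Shimura1998, §5.1 Proposition 5 (p. 38)] -/
theorem isCMField_of_trace_mul_nonneg_over (ρ : M →+* M)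
    (hρ : ∀ x : M, 0 ≤ Algebra.trace ℚ M (x * ρ x)) : IsCMField M :=
  (ne_id_and_isCMField_of_trace_mul_nonneg_over φ hM ρ hρ).2

omit φ hM in
/-- … and `ρ` is complex conjugation under every complex embedding: `σ (ρ x) = conj (σ x)` (Lemma 2,
no geometric input). [cite: Shimura1998, §5.1 Lemma 2 (p. 37)] -/
theorem apply_eq_conj_of_trace_mul_nonneg_over (ρ : M →+* M)
    (hρ : ∀ x : M, 0 ≤ Algebra.trace ℚ M (x * ρ x)) (σ : M →+* ℂ) (x : M) : σ (ρ x) = conj (σ x) :=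
  apply_eq_conj_of_trace_mul_nonneg ρ hρ σ x

/-- … and `ρ` IS the complex conjugation `IsCMField.complexConj` of the CM field `M`.
[cite: Shimura1998, §5.1 Proposition 5 and Lemma 2 (pp. 37–38)] -/
theorem eq_complexConj_of_trace_mul_nonneg_over (ρ : M →+* M)
    (hρ : ∀ x : M, 0 ≤ Algebra.trace ℚ M (x * ρ x)) (x : M) :
    ρ x = (@IsCMField.complexConj M _ _ (isCMField_of_trace_mul_nonneg_over φ hM ρ hρ) _) x :=
  eq_complexConj_of_trace_mul_nonneg ρ hρ (ne_id_and_isCMField_of_trace_mul_nonneg_over φ hM ρ hρ).1 x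

/-! ## §3 `B₀` simple over `k`: a trace-non-negative endomorphism of `End⁰_k(B₀)` makes `M` CM -/

/-- **For `B₀` SIMPLE over `k ⊆ ℂ` with a number field `M → End⁰_k(B₀)` of degree `2 dim B₀`** (so that
`M ≅ End⁰_k(B₀)`, ★ `bijective_of_isSimple_over_of_finrank_eq`): if `End⁰_k(B₀)` carries a ring endomorphism
`τ` with non-negative trace form `0 ≤ Tr(L_{x·τx})` (trace of left multiplication on the `ℚ`-vector space
`End⁰_k(B₀)`) — the Rosati involution of a `k`-rational
polarisation, an ANTI-automorphism in print, which on the commutative `End⁰_k(B₀)` is a ring endomorphism —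
then `M` is a CM field and the pulled-back endomorphism is `≠ id`. [cite: Shimura1998, §5.1 Proposition 5 (p. 38)]
[cite: MumfordAV1970, §21 Thm. 1] [cite: Liu2021, App. D §D.4 (FJcycle.tex l. 5626–5627)] -/
theorem isCMField_of_isSimple_over_of_trace_mul_nonneg (hS : B₀.IsSimple)
    (τ : B₀.endAlgebra →+* B₀.endAlgebra)
    (hτ : ∀ x : B₀.endAlgebra, 0 ≤ LinearMap.trace ℚ B₀.endAlgebra (Algebra.lmul ℚ B₀.endAlgebra (x * τ x))) :
    IsCMField M := by
  have hbij := bijective_of_isSimple_over_of_finrank_eq hS φ hM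
  let e : M ≃+* B₀.endAlgebra := RingEquiv.ofBijective φ hbij
  have he : ∀ m, e m = φ m := fun _ => rfl
  -- the pulled-back endomorphism `ρ = e⁻¹ ∘ τ ∘ e` of `M`
  let ρ : M →+* M := (e.symm.toRingHom.comp τ).comp e.toRingHom
  have hρφ : ∀ m, φ (ρ m) = τ (φ m) := fun m => by
    change e (e.symm (τ (e m))) = τ (φ m)
    rw [RingEquiv.apply_symm_apply, he]
  refine isCMField_of_trace_mul_nonneg_over φ hM ρ fun x => ?_
  rw [← trace_lmul_eq_trace_of_bijective φ hbij, map_mul, hρφ]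
  exact hτ (φ x)

/-- The ANTI-endomorphism form of §3: a map `τ : End⁰_k(B₀) →+* End⁰_k(B₀)ᵐᵒᵖ` (an involution «of the
second kind» as printed, `(xy)† = y† x†`) with `0 ≤ Tr(x·x†)` makes `M` a CM field — on the commutative
`End⁰_k(B₀)` (★ `endAlgebra_comm_of_isSimple_over_of_ringHom`) `x ↦ (τ x).unop` is a ring endomorphism.
[cite: Shimura1998, §5.1 Proposition 5 (p. 38)] [cite: MumfordAV1970, §21 Thm. 1] -/
theorem isCMField_of_isSimple_over_of_trace_mul_unop_nonneg (hS : B₀.IsSimple)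
    (τ : B₀.endAlgebra →+* (B₀.endAlgebra)ᵐᵒᵖ)
    (hτ : ∀ x : B₀.endAlgebra, 0 ≤ LinearMap.trace ℚ B₀.endAlgebra (Algebra.lmul ℚ B₀.endAlgebra (x * (τ x).unop))) :
    IsCMField M := by
  have hcomm := endAlgebra_comm_of_isSimple_over_of_ringHom hS φ hM
  let τ' : B₀.endAlgebra →+* B₀.endAlgebra :=
    { toFun := fun x => (τ x).unop
      map_one' := by rw [map_one, MulOpposite.unop_one]
      map_mul' := fun x y => by rw [map_mul, MulOpposite.unop_mul, hcomm]
      map_zero' := by rw [map_zero, MulOpposite.unop_zero]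
      map_add' := fun x y => by rw [map_add, MulOpposite.unop_add] }
  exact isCMField_of_isSimple_over_of_trace_mul_nonneg φ hM hS τ' hτ

end OverSubfield

end Literature.AlgebraicGeometry.ComplexMultiplication

end
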